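import Summits.NavierStokesRegularity.NavierStokesRegularity.Theorems.TypeICertificateLadderNoBlowupToClay
import Literature.Analysis.FluidPDE.NSVorticityBKMHolds
import Literature.Analysis.FluidPDE.TaoLocalisationHolds
import Literature.Analysis.FluidPDE.LerayHopfConcatenation
import HarnessLib

/-!
# Bridge «Beale–Kato–Majda bound for all classical Leray–Hopf solutions ⇒ Clay (A)»

Companion of the `L³` / `Ḣ^{1/2}` / `H^{1/2}` / sup-bound bridges
(`Theorems/StrongHypotheses*Bridge.lean`, p458363 / p458804 / p461705 / p463996): the BKM-type strong
hypothesis of the registry `Literature/StrongHypotheses/NavierStokesRegularity.lean` (census row 7, "for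
every classical Leray–Hopf solution from a Clay datum, `∫₀ᵀ ‖curl u(t)‖_∞ dt < ∞` for all finite `T`")
implies Fefferman's (A). Claimed regularity proofs of the vorticity / a-priori-identity families
(cell `ns-claims`, D-0090: C17's chain ends in the BKM integral, C03's and C14's in vorticity bounds)
compose with (A) through exactly this implication; it is CLASSICAL and landed here in the kernel over
theorems of the tree:

* Beale–Kato–Majda continuation, DISCHARGED: `Literature.Analysis.FluidPDE.beale_kato_majda_holds`
  (Majda–Bertozzi 2002, Thm. 3.6: in the BKM class, continuation past `T` ⇔ `∫₀ᵀ‖ω‖_∞ < ∞`);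
* regularity persistence of classical finite-energy solutions from Schwartz data on CLOSED slabs,
  DISCHARGED: `tao2011_hasBoundedSobolevNormsOn_holds` (Tao 2013, Cor. 11.1 + Cor. 4.3 + Thm. 5.4), which
  puts a classical Leray–Hopf solution from a Clay datum into the BKM class on every `[0,T'']`, `T'' < T`;
* the Leray–Hopf energy bound `IsLerayHopfOn.kineticEnergy_le_of_zero_force`;
* «no finite-time blow-up ⇒ (A)»: `typeICertificateLadder_noBlowupToClay_proof` (stmt-NavierStokesRegularity-0055).

The hypothesis is written as an explicit binder (no new definition); it is OPEN — only the implication is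
asserted.

WHAT THIS IS NOT: not a claim about NS regularity or blow-up; not a claim about any author beyond the typed locator.

## References

* J. T. Beale, T. Kato, A. Majda, Comm. Math. Phys. 94 (1984), 61–66. [`BealeKatoMajda1984`]
* A. J. Majda, A. L. Bertozzi, *Vorticity and Incompressible Flow* (2002), Thm. 3.6. [`MajdaBertozzi2002`]
* T. Tao, Anal. PDE 6 (2013) = arXiv:1108.1165, Cor. 11.1, Cor. 4.3, Thm. 5.4. [`Tao2013Localisation`]
-/

noncomputable section

namespace Summit.NavierStokesRegularity.StrongHypotheses

open Set MeasureTheory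
open scoped ENNReal NNReal ContDiff
open Literature.Analysis.FluidPDE
open Summit.NavierStokesRegularity.NavierStokesRegularity.Theorems
  (typeICertificateLadder_noBlowupToClay_proof)

/-- **A classical Leray–Hopf solution from a rapidly decaying datum lies in the BKM class on every
closed sub-slab `[0,T'']`, `T'' < T`** (all `L²` Sobolev norms bounded there): the energy bound of the
Leray–Hopf class (`IsLerayHopfOn.kineticEnergy_le_of_zero_force`) feeds Tao's persistence-of-regularity
theorem on closed slabs (`tao2011_hasBoundedSobolevNormsOn_holds`, Tao 2013 Cor. 11.1 + Cor. 4.3 +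
Thm. 5.4). [cite: Tao2013Localisation, Cor. 11.1 with Cor. 4.3 and Thm. 5.4 (iv)] -/
theorem hasBoundedSobolevNormsOn_of_classical_lerayHopf {ν T : ℝ} (hν : 0 < ν)
    {u : ℝ → EuclideanSpace ℝ (Fin 3) → EuclideanSpace ℝ (Fin 3)}
    {p : ℝ → EuclideanSpace ℝ (Fin 3) → ℝ}
    (hcl : IsClassicalNSSolutionOn (Ico 0 T) ν 0 u p) (hLH : IsLerayHopfOn T ν 0 (u 0) u)
    (hdec : HasRapidSpatialDecay (u 0)) :
    ∀ T'' < T, HasBoundedSobolevNormsOn (Icc 0 T'') u := by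
  intro T'' hT''
  rcases lt_or_ge 0 T'' with hpos | hnonpos
  · -- a genuine closed slab `[0, T'']`, `0 < T'' < T`
    have hsub : Icc (0:ℝ) T'' ⊆ Ico 0 T := fun t ht => ⟨ht.1, ht.2.trans_lt hT''⟩
    have hcl' : IsClassicalNSSolutionOn (Icc 0 T'') ν 0 u p := hcl.mono hsub (uniqueDiffOn_Icc hpos)
    have hE : ∃ C : ℝ≥0, ∀ t ∈ Icc (0:ℝ) T'', ∫⁻ x, ‖u t x‖ₑ ^ 2 ≤ C := by
      refine ⟨(2 * VectorCalculus.kineticEnergy (u 0)).toNNReal, fun t ht => ?_⟩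
      have htT : t ∈ Icc (0:ℝ) T := ⟨ht.1, (ht.2.trans_lt hT'').le⟩
      have hmem : MemLp (u t) 2 volume := hLH.memLp t htT
      have hkin := hLH.kineticEnergy_le_of_zero_force hν.le htT
      calc ∫⁻ x, ‖u t x‖ₑ ^ 2 = eEnergy (u t) := rfl
        _ = ENNReal.ofReal (2 * VectorCalculus.kineticEnergy (u t)) := eEnergy_eq_ofReal _ hmem
        _ ≤ ENNReal.ofReal (2 * VectorCalculus.kineticEnergy (u 0)) :=
            ENNReal.ofReal_le_ofReal (by linarith)
        _ = ((2 * VectorCalculus.kineticEnergy (u 0)).toNNReal : ℝ≥0∞) := rfl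
    exact tao2011_hasBoundedSobolevNormsOn_holds hν hpos hcl' hE hdec
  · -- degenerate slab: `Icc 0 T'' ⊆ {0}`, where `u 0` is the Clay datum (all Sobolev norms finite)
    intro n
    refine ⟨(∫⁻ x, ‖iteratedFDeriv ℝ n (u 0) x‖ₑ ^ 2).toNNReal, fun t ht => ?_⟩
    have ht0 : t = 0 := le_antisymm (ht.2.trans hnonpos) ht.1
    subst ht0
    exact le_of_eq (ENNReal.coe_toNNReal (hdec.lintegral_enorm_iteratedFDeriv_sq_lt_top n).ne).symm

/-- **BKM bound ⇒ no blow-up.** If every classical solution `(u, p)` of the unforced Navier–Stokes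
system on `ℝ³ × [0,T)` (`ν > 0`) which is Leray–Hopf on `[0,T]` from its rapidly decaying datum obeys
`∫₀ᵀ ‖curl u(t)‖_∞ dt < ∞` (the tree's `∫⁻ t ∈ (0,T), ⨆ₓ ‖curl (u t) x‖ₑ`), then every such solution
extends smoothly past `T`: the solution is in the BKM class on compact sub-slabs
(`hasBoundedSobolevNormsOn_of_classical_lerayHopf`), so the DISCHARGED Beale–Kato–Majda criterion
`beale_kato_majda_holds` gives a Sobolev extension, in particular a smooth one.
[cite: MajdaBertozzi2002, Thm. 3.6 (p. 115) and its proof (pp. 116-117)] -/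
theorem noBlowup_of_classicalBKMBound
    (H : ∀ (ν T : ℝ), 0 < ν → 0 < T →
      ∀ (u : ℝ → EuclideanSpace ℝ (Fin 3) → EuclideanSpace ℝ (Fin 3))
        (p : ℝ → EuclideanSpace ℝ (Fin 3) → ℝ),
        IsClassicalNSSolutionOn (Ico 0 T) ν 0 u p → IsLerayHopfOn T ν 0 (u 0) u →
          HasRapidSpatialDecay (u 0) → (∫⁻ t in Ioo 0 T, ⨆ x, ‖curl (u t) x‖ₑ) < ⊤) :
    ∀ (ν T : ℝ), 0 < ν → 0 < T →
      ∀ (u : ℝ → EuclideanSpace ℝ (Fin 3) → EuclideanSpace ℝ (Fin 3))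
        (p : ℝ → EuclideanSpace ℝ (Fin 3) → ℝ),
        IsClassicalNSSolutionOn (Ico 0 T) ν 0 u p → IsLerayHopfOn T ν 0 (u 0) u →
          HasRapidSpatialDecay (u 0) → HasSmoothExtensionPast ν 0 u T := by
  intro ν T hν hT u p hcl hLH hdec
  have hreg := hasBoundedSobolevNormsOn_of_classical_lerayHopf hν hcl hLH hdec
  exact ((beale_kato_majda_holds hν.le hT hcl hreg).2 (H ν T hν hT u p hcl hLH hdec)).hasSmoothExtensionPast

/-- **BKM bound for all classical Leray–Hopf solutions from Clay data ⇒ Clay (A).** If every classical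
solution of the unforced Navier–Stokes system on `ℝ³ × [0,T)`, `ν > 0`, Leray–Hopf on `[0,T]` from its
smooth rapidly decaying datum, has `∫₀ᵀ ‖curl u‖_∞ < ∞`, then Fefferman's Clay statement (A)
(`NavierStokesRegularity`) holds (`noBlowup_of_classicalBKMBound` + the landed frame
`typeICertificateLadder_noBlowupToClay_proof`). The hypothesis (registry row 7) is OPEN; only the
implication is asserted. [cite: BealeKatoMajda1984, main theorem (continuation criterion)] -/
theorem navierStokesRegularity_of_classicalBKMBound
    (H : ∀ (ν T : ℝ), 0 < ν → 0 < T →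
      ∀ (u : ℝ → EuclideanSpace ℝ (Fin 3) → EuclideanSpace ℝ (Fin 3))
        (p : ℝ → EuclideanSpace ℝ (Fin 3) → ℝ),
        IsClassicalNSSolutionOn (Ico 0 T) ν 0 u p → IsLerayHopfOn T ν 0 (u 0) u →
          HasRapidSpatialDecay (u 0) → (∫⁻ t in Ioo 0 T, ⨆ x, ‖curl (u t) x‖ₑ) < ⊤) :
    _root_.NavierStokesRegularity :=
  typeICertificateLadder_noBlowupToClay_proof (noBlowup_of_classicalBKMBound H)

end Summit.NavierStokesRegularity.StrongHypotheses

end
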